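import Mathlib.Topology.Sequences
import Mathlib.Analysis.Normed.Group.Tannery
import Literature.NumberTheory.LFunctions.WeilMellinBounds
import Literature.NumberTheory.LFunctions.WeilMellinInversion
import HarnessLib

/-!
# Lemma DC: exactness survives the limit of designs (`stub_compactness`)

Stub `stub_compactness` of the line `defect-compactness-design` for the crux `WindowTraceArch`
(stmt-RiemannHypothesis-11195; skeleton
`Summit.RiemannHypothesis.RiemannHypothesis.Cruxes.WindowTraceArch.DefectCompactnessDesign`).

**Statement.** Assume the domination lemma of the line (the statement of `stub_domination`, taken
here as a hypothesis): along a configuration `x : ℕ → ℝ` with a polynomial local count profile and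
inside a displacement budget `D`, the transform `f̂(1/2 + i(x n + v))` (`|v| ≤ D`) of every Weil test
`f` is dominated by a summable sequence. Let `x` be such a configuration, `g j` (`j ∈ ℕ`) Weil tests,
and `δ k : ℕ → ℝ` (`k ∈ ℕ`) displacements with the common budget `|δ k n| ≤ D` such that, for each
`j`, the unit-atomic family `n ↦ x n + δ k n` reproduces the Weil functional `W(g j)` exactly
(`HasSum`) for all large `k`. Then ONE displacement `δ'` with `|δ' n| ≤ D` reproduces every `W(g j)`.

**Proof sketch.** The cube `{δ | ∀ n, δ n ∈ [-D, D]}` is compact in the product topology of `ℕ → ℝ`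
(Tychonoff, `isCompact_univ_pi`) and `ℕ → ℝ` is first countable, so a subsequence `δ (φ k)`
converges pointwise to some `δ'` in the cube (`IsCompact.tendsto_subseq`, `tendsto_pi_nhds`). Fix
`j`. The terms `ĝⱼ(1/2 + i(x n + δ (φ k) n))` converge to `ĝⱼ(1/2 + i(x n + δ' n))` by continuity of
the entire function `ĝⱼ = weilMellin (g j)` (`continuous_weilMellin`), and they are dominated,
uniformly in `k`, by the summable sequence supplied by the domination hypothesis; Tannery's theorem
(`tendsto_tsum_of_dominated_convergence`) gives `∑' n, ĝⱼ(1/2 + i(x n + δ' n)) = lim_k ∑' n,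
ĝⱼ(1/2 + i(x n + δ (φ k) n)) = W(g j)`, the sequence of sums being eventually constant (`φ k ≥ k`).
The limit family is absolutely summable (dominated), hence `HasSum`.

**Sources.** Standard point-set topology and analysis: Tychonoff's theorem for a countable product of
compact intervals, sequential compactness of compact first-countable spaces, and Tannery's theorem
(dominated convergence for series); e.g. J. L. Kelley, *General Topology* (1955), Ch. 5 and 7;
T. J. I'A. Bromwich, *An Introduction to the Theory of Infinite Series* (1908), §49. All
ingredients are proved tree / Mathlib facts. [folklore]
-/

set_option linter.dupNamespace false

noncomputable section

open Complex Filter Set MeasureTheory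
open scoped Real Topology BigOperators

namespace Summit.RiemannHypothesis.RiemannHypothesis.Theorems.SpectralTraceWindowTraceArch

open Literature.NumberTheory.LFunctions

/-- Continuity of the transform of a Weil test along the critical line, as a function of the real
ordinate: `u ↦ ĝ(1/2 + iu)` is continuous (`ĝ` is entire). [folklore] -/
theorem stub_compactness_continuous_line {f : ℝ → ℂ} (hf : IsWeilTest f) :
    Continuous fun u : ℝ => weilMellin f (1 / 2 + (u : ℂ) * I) :=
  (continuous_weilMellin hf.1.continuous hf.2).comp (by fun_prop)

/-- Passage to the limit in one exact series: if the displacements `d k : ℕ → ℝ` converge pointwise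
to `d'`, the terms `ĝ(1/2 + i(x n + d k n))` are dominated by a summable `b` uniformly in `k`, the
limit terms are dominated by `b` as well, and the series of stage `k` has sum `W` for all large `k`,
then the limit series has sum `W` (Tannery's theorem plus continuity of `ĝ`). [folklore] -/
theorem stub_compactness_hasSum_limit {f : ℝ → ℂ} (hf : IsWeilTest f) (x : ℕ → ℝ)
    (d : ℕ → ℕ → ℝ) (d' : ℕ → ℝ) (b : ℕ → ℝ) (W : ℂ) (hb : Summable b)
    (hdom : ∀ k n, ‖weilMellin f (1 / 2 + ((x n + d k n : ℝ) : ℂ) * I)‖ ≤ b n)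
    (hdom' : ∀ n, ‖weilMellin f (1 / 2 + ((x n + d' n : ℝ) : ℂ) * I)‖ ≤ b n)
    (hlim : ∀ n, Tendsto (fun k => d k n) atTop (𝓝 (d' n)))
    (hev : ∀ᶠ k in atTop,
      HasSum (fun n => weilMellin f (1 / 2 + ((x n + d k n : ℝ) : ℂ) * I)) W) :
    HasSum (fun n => weilMellin f (1 / 2 + ((x n + d' n : ℝ) : ℂ) * I)) W := by
  set F : ℕ → ℕ → ℂ := fun k n => weilMellin f (1 / 2 + ((x n + d k n : ℝ) : ℂ) * I) with hF
  set G : ℕ → ℂ := fun n => weilMellin f (1 / 2 + ((x n + d' n : ℝ) : ℂ) * I) with hG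
  -- termwise convergence, by continuity of `u ↦ ĝ(1/2 + iu)`
  have hFG : ∀ n, Tendsto (fun k => F k n) atTop (𝓝 (G n)) := by
    intro n
    have h1 : Tendsto (fun k => x n + d k n) atTop (𝓝 (x n + d' n)) :=
      tendsto_const_nhds.add (hlim n)
    exact ((stub_compactness_continuous_line hf).tendsto _).comp h1
  -- domination, uniformly in `k`
  have hbound : ∀ᶠ k in atTop, ∀ n, ‖F k n‖ ≤ b n :=
    Eventually.of_forall fun k n => hdom k n
  -- Tannery
  have hT : Tendsto (fun k => ∑' n, F k n) atTop (𝓝 (∑' n, G n)) :=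
    tendsto_tsum_of_dominated_convergence hb hFG hbound
  -- the sums of stage `k` are eventually equal to `W`
  have hconst : Tendsto (fun k => ∑' n, F k n) atTop (𝓝 W) := by
    refine tendsto_const_nhds.congr' ?_
    filter_upwards [hev] with k hk
    exact hk.tsum_eq.symm
  have hGW : ∑' n, G n = W := tendsto_nhds_unique hT hconst
  -- the limit family is absolutely summable, hence `HasSum` to its `tsum`
  have hGsum : Summable G := Summable.of_norm_bounded hb fun n => hdom' n
  rw [← hGW]
  exact hGsum.hasSum

/-- **stub_compactness — Lemma DC: exactness survives the limit of designs, given domination.**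
Let `x` be a configuration with a polynomial local count profile, `gⱼ` Weil tests, and `δ k`
(`k ∈ ℕ`) displacements with the common budget `D` such that, for each `j`, the family
`n ↦ x n + δ k n` reproduces `W(gⱼ)` exactly for all large `k`. Then ONE displacement `δ'` within the
same budget reproduces every `W(gⱼ)`. Proof: the cube `{δ | ∀ n, δ n ∈ [-D, D]}` is compact in the
product topology (`isCompact_univ_pi`) and `ℕ → ℝ` is first countable, so a subsequence `δ (φ k)`
converges pointwise to some `δ'` in the cube (`IsCompact.tendsto_subseq`); for fixed `j` the
domination hypothesis gives a summable `b` dominating `‖ĝⱼ(1/2 + i(x n + v))‖` for all `|v| ≤ D`;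
Tannery's theorem (`tendsto_tsum_of_dominated_convergence`) and continuity of `u ↦ ĝⱼ(1/2 + iu)`
give `∑ₙ ĝⱼ(1/2 + i(x n + δ' n)) = lim_k W(gⱼ) = W(gⱼ)`; the limit family is absolutely summable
(dominated by `b`), hence `HasSum`. [folklore] -/
theorem stub_compactness :
    (∀ (x : ℕ → ℝ) (C D : ℝ) (N : ℕ),
      (∀ (T : ℝ) (s : Finset ℕ), (∀ n ∈ s, |x n - T| ≤ 1) → (s.card : ℝ) ≤ C * (1 + |T|) ^ N) →
      ∃ (K : ℝ) (k : ℕ), ∀ f : ℝ → ℂ, Literature.NumberTheory.LFunctions.IsWeilTest f →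
        ∃ b : ℕ → ℝ, Summable b ∧
          (∀ (n : ℕ) (v : ℝ), |v| ≤ D →
            ‖Literature.NumberTheory.LFunctions.weilMellin f (1 / 2 + ((x n + v : ℝ) : ℂ) * Complex.I)‖ ≤ b n) ∧
          ∑' n, b n ≤ K * ((∫ t, ‖f t‖) + ∫ t, ‖iteratedDeriv k f t‖)) →
    ∀ (x : ℕ → ℝ) (C D : ℝ) (N : ℕ) (g : ℕ → ℝ → ℂ) (δ : ℕ → ℕ → ℝ),
      (∀ (T : ℝ) (s : Finset ℕ), (∀ n ∈ s, |x n - T| ≤ 1) → (s.card : ℝ) ≤ C * (1 + |T|) ^ N) →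
      (∀ j, Literature.NumberTheory.LFunctions.IsWeilTest (g j)) → (∀ k n, |δ k n| ≤ D) →
      (∀ j, ∀ᶠ k in Filter.atTop,
        HasSum (fun n => Literature.NumberTheory.LFunctions.weilMellin (g j) (1 / 2 + ((x n + δ k n : ℝ) : ℂ) * Complex.I))
          (Literature.NumberTheory.LFunctions.weilFunctional (g j))) →
      ∃ δ' : ℕ → ℝ, (∀ n, |δ' n| ≤ D) ∧
        ∀ j, HasSum (fun n => Literature.NumberTheory.LFunctions.weilMellin (g j) (1 / 2 + ((x n + δ' n : ℝ) : ℂ) * Complex.I))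
          (Literature.NumberTheory.LFunctions.weilFunctional (g j)) := by
  intro hdom x C D N g δ hP hg hδ hev
  -- domination data: for each test `g j`, a summable `b j` dominating its transform in the budget
  obtain ⟨K, k, hKk⟩ := hdom x C D N hP
  choose b hbsum hbdom _hbK using fun j => hKk (g j) (hg j)
  -- compactness of the cube `[-D, D]^ℕ` in the (first-countable) product topology
  set S : Set (ℕ → ℝ) := Set.pi Set.univ (fun _ : ℕ => Set.Icc (-D) D) with hS_def
  have hS : IsCompact S := isCompact_univ_pi fun _ => isCompact_Icc
  have hδS : ∀ k, δ k ∈ S := fun k => Set.mem_univ_pi.2 fun n => abs_le.1 (hδ k n)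
  obtain ⟨a, haS, φ, hφ, hlim⟩ := hS.tendsto_subseq hδS
  have ha : ∀ n, |a n| ≤ D := fun n => abs_le.2 (Set.mem_univ_pi.1 haS n)
  -- pointwise convergence of the subsequence of displacements
  have hpt : ∀ n, Tendsto (fun k => δ (φ k) n) atTop (𝓝 (a n)) := fun n =>
    tendsto_pi_nhds.1 hlim n
  refine ⟨a, ha, fun j => ?_⟩
  -- exactness along the subsequence, eventually (`φ k ≥ k`)
  have hevφ : ∀ᶠ k in atTop, HasSum
      (fun n => weilMellin (g j) (1 / 2 + ((x n + δ (φ k) n : ℝ) : ℂ) * I))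
      (weilFunctional (g j)) :=
    hφ.tendsto_atTop.eventually (hev j)
  exact stub_compactness_hasSum_limit (hg j) x (fun k => δ (φ k)) a (b j) (weilFunctional (g j))
    (hbsum j) (fun k n => hbdom j n _ (hδ (φ k) n)) (fun n => hbdom j n _ (ha n)) hpt hevφ

end Summit.RiemannHypothesis.RiemannHypothesis.Theorems.SpectralTraceWindowTraceArch

end
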